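import Mathlib
import Literature.Probability.Percolation.DiagonalStripPairingClosedForm
import Literature.Probability.Percolation.DiagonalStripGenericSimplicity
import Literature.Probability.Percolation.DiagonalStripLumping
import HarnessLib

/-!
# The homogeneous percolation point: Ikhlef–Ponsaing's Prop. 4.7 from the ground-state bounds

Topic `Literature/Probability/Percolation`. Ikhlef–Ponsaing (J. Stat. Phys. 149 (2012),
arXiv:1202.5476) §4.4: at the homogeneous point the left-passage probability is
`χ_{L-1}(1) χ_{L+1}(1) / χ_L(1)²`. This file specialises the `U`-world closed form
`N̂ = κ² Ĉ`, `Ẑ = κ χ̂_L` (`DiagonalStripPairingClosedForm`) to the percolation point `w = w₀`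
(`w₀² = -q`), `z_k = 1` (`ipEvalPt`), where `t(w; z⃗)` is the lumped percolation kernel `t(½)`
(`DiagonalStripGenericSimplicity`):

* `IsGroundState.sum_mul_ipNMat`, `IsGroundState.eval_vecMul` — the evaluated ground state
  `π̂_Q = P_Q(w₀; 1⃗)` is a left fixed vector of `t(½)`, hence `π̂ = c π̄` (`ipTMat0_complex_vecMul_line`);
* `eval_uSq`, `eval_revPoly_of_one`, `eval_revAll_of_one`, `eval_sq_uChar` (`= ipSpDim L`),
  `eval_sq_cHat` (`= ipSpDim(2n) ipSpDim(2n+2)`);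
* **`IsGroundState.stationary_pairing`**: `Σ_{Q,Q'} π̄_Q π̄_{Q'} J(Q,Q') = ipSpDim(2n) ipSpDim(2n+2) / ipSpDim(2n+1)²`;
* **`ikhlefPonsaingFirstPassage_of_bounds`**: `IkhlefPonsaingFirstPassage` follows from the
  `GroundStateBounds` of the primitive exact ground state at every width `≥ 1`
  (via `ikhlefPonsaingFirstPassage_iff_lumped_pairing`).

## References

* Y. Ikhlef, A. K. Ponsaing, *Finite-size left-passage probability in percolation*, J. Stat. Phys.
  149 (2012) 10–36, arXiv:1202.5476, §3.4, §4.4, Props. 4.5, 4.7. [IkhlefPonsaing2012]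
-/

namespace Literature.Probability.Percolation

open Finset Literature.Probability.LatticeModels Literature.Probability.LatticeModels.TemperleyLieb

section Homogeneous

open MvPolynomial Matrix Literature.Combinatorics.Enumerative

variable {n : ℕ} {q : ℂ}

/-- **The polynomial identity behind `t`-fixedness**: `Σ_Q P_Q · (Δ(t-1))_{Q,Q'} = 0`. [folklore] -/
theorem IsGroundState.sum_mul_ipNMat (hq : q ^ 2 + q + 1 = 0) {P : ColPattern n → MvPolynomial ℕ ℂ} {a : ℤ}
    (h : IsGroundState n q P a) (Q' : ColPattern n) : ∑ Q, P Q * ipNMat n q Q Q' = 0 := by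
  have hq0 : q ≠ 0 := q_ne_zero_of_quad hq
  apply toRF_injective (K₀ := ℂ)
  rw [map_sum, map_zero]
  have hent : ∀ Q, toRF ℂ (ipNMat n q Q Q') = toRF ℂ (ipDeltaPoly n q) * (ipTMat n q - 1) Q Q' := fun Q => by
    have := congrFun (congrFun (mapMatrix_toRF_ipNMat (m := n) (K₀ := ℂ) hq0) Q) Q'
    rw [RingHom.mapMatrix_apply, Matrix.map_apply] at this
    rw [this, Matrix.smul_apply, smul_eq_mul]
  simp only [map_mul, hent]
  have hfix := h.fixed Q'
  classical
  have hsplit : ∀ Q, toRF ℂ (P Q) * (toRF ℂ (ipDeltaPoly n q) * (ipTMat n q - 1) Q Q') =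
      toRF ℂ (ipDeltaPoly n q) * (ipTMat n q Q Q' * toRF ℂ (P Q)) -
        toRF ℂ (ipDeltaPoly n q) * (if Q = Q' then toRF ℂ (P Q) else 0) := fun Q => by
    rw [Matrix.sub_apply, Matrix.one_apply]
    split_ifs <;> ring
  rw [Finset.sum_congr rfl fun Q _ => hsplit Q, Finset.sum_sub_distrib, ← Finset.mul_sum, ← Finset.mul_sum,
    Finset.sum_ite_eq' Finset.univ Q', if_pos (Finset.mem_univ _)]
  simp only [ipTMat_apply]
  rw [hfix, sub_self]

/-- **At the percolation point the evaluated ground state is a left fixed vector of `t(½)`.**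
[cite: IkhlefPonsaing2012, §3.4, §4.4] -/
theorem IsGroundState.eval_vecMul (hq : q ^ 2 + q + 1 = 0) {w₀ : ℂ} (hw : w₀ ^ 2 = -q)
    {P : ColPattern n → MvPolynomial ℕ ℂ} {a : ℤ} (h : IsGroundState n q P a) :
    (fun Q => eval (ipEvalPt w₀) (P Q)) ᵥ* (ipTMat0 ℂ n - 1) = 0 := by
  have hΔ := eval_ipDeltaPoly_ne_zero (m := n) hq hw (two_ne_zero (α := ℂ))
  funext Q'
  have h0 := congrArg (eval (ipEvalPt w₀)) (h.sum_mul_ipNMat hq Q')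
  rw [map_sum, map_zero] at h0
  have hent : ∀ Q, eval (ipEvalPt w₀) (ipNMat n q Q Q') = eval (ipEvalPt w₀) (ipDeltaPoly n q) * (ipTMat0 ℂ n - 1) Q Q' := by
    intro Q
    have := congrFun (congrFun (mapMatrix_eval_ipNMat (m := n) (K₀ := ℂ) hq hw two_ne_zero) Q) Q'
    rw [RingHom.mapMatrix_apply, Matrix.map_apply] at this
    rw [this, Matrix.smul_apply, smul_eq_mul]
  simp only [map_mul, hent] at h0
  rw [Matrix.vecMul, dotProduct, Pi.zero_apply]
  apply mul_left_cancel₀ hΔ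
  rw [mul_zero, Finset.mul_sum, ← h0]
  exact Finset.sum_congr rfl fun Q _ => by ring

/-- Evaluation after squaring the variables. [folklore] -/
theorem eval_uSq (g : ℕ → ℂ) (F : MvPolynomial ℕ ℂ) : eval g (uSq ℂ F) = eval (fun k => g k ^ 2) F := by
  rw [uSq, ← AlgHom.coe_toRingHom, ← RingHom.comp_apply]
  congr 1
  refine ringHom_ext (fun c => by simp) (fun k => by simp)

/-- **Evaluation at a point with `g_k = 1` does not see the reversal at `k`.** [folklore] -/
theorem eval_revPoly_of_one {g : ℕ → ℂ} {k : ℕ} (hg : g k = 1) (N : ℕ) (F : MvPolynomial ℕ ℂ) :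
    eval g (revPoly k N F) = eval g F := by
  have key : ∀ G : MvPolynomial ℕ ℂ, eval g (substHom k 1 G) = eval g G := fun G => by
    rw [substHom, ← AlgHom.coe_toRingHom, ← RingHom.comp_apply]
    congr 1
    refine ringHom_ext (fun c => by simp) (fun i => ?_)
    simp only [RingHom.comp_apply, AlgHom.coe_toRingHom, aeval_X, eval_X]
    by_cases hi : i = k
    · subst hi; simp [hg]
    · rw [Function.update_of_ne hi, eval_X]
  rw [← key, substHom_one_revPoly, key]

/-- And hence not the full reversal, at a point with `g_k = 1` on the window. [folklore] -/
theorem eval_revAll_of_one {g : ℕ → ℂ} (N : ℕ) : ∀ {L : ℕ}, (∀ k, 1 ≤ k → k ≤ L → g k = 1) →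
    ∀ F : MvPolynomial ℕ ℂ, eval g (revAll ℂ N L F) = eval g F
  | 0, _, _ => rfl
  | L + 1, hg, F => by
    rw [revAll, eval_revPoly_of_one (hg (L + 1) (by omega) le_rfl), eval_revAll_of_one N (fun k hk hkL => hg k hk (by omega)) F]

/-- **`χ̂_L` at the squared percolation point is `ipSpDim L`.** [cite: IkhlefPonsaing2012, §4.4] -/
theorem eval_sq_uChar (w₀ : ℂ) (u L : ℕ) (hu : 1 ≤ u) :
    eval (fun k => ipEvalPt w₀ k ^ 2) (uChar ℂ u L) = ((ipSpDim L : ℚ) : ℂ) := by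
  rw [← eval_one_uChar (K₀ := ℂ) u L]
  refine eval_eq_of_degreeOf (uChar ℂ u L) fun k hk => ?_
  have := degreeOf_uChar_le (K₀ := ℂ) u L k
  have hk0 : k ≠ 0 := by
    rintro rfl
    rw [if_neg (by simp; omega)] at this
    exact hk (Nat.eq_zero_of_le_zero this)
  simp [ipEvalPt, hk0]

/-- **`Ĉ_n` at the squared percolation point is `ipSpDim(2n) · ipSpDim(2n+2)`.** [cite: IkhlefPonsaing2012, §4.4] -/
theorem eval_sq_cHat (w₀ : ℂ) (n : ℕ) :
    eval (fun k => ipEvalPt w₀ k ^ 2) (cHat ℂ n) = ((ipSpDim (2 * n) * ipSpDim (2 * n + 2) : ℚ) : ℂ) := by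
  rw [cHat, map_mul, map_mul, map_prod, eval_sq_uChar w₀ 1 _ le_rfl, eval_rename]
  have hcomp : ((fun k => ipEvalPt w₀ k ^ 2) ∘ dblMap (2 * n + 1)) = fun k => ipEvalPt w₀ k ^ 2 := by
    funext k
    by_cases hk : k = 2 * n + 1 + 1
    · subst hk
      simp only [Function.comp, dblMap_succ, ipEvalPt, if_neg (show 2 * n + 1 ≠ 0 by omega),
        if_neg (show 2 * n + 1 + 1 ≠ 0 by omega)]
    · simp only [Function.comp, dblMap_of_ne hk]
  rw [hcomp, eval_sq_uChar w₀ 1 _ le_rfl, Finset.prod_eq_one fun k hk => by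
    rw [eval_X]; simp [ipEvalPt, show k ≠ 0 by simp only [Finset.mem_Icc] at hk; omega]]
  push_cast; ring

/-- **The stationary pairing at width `n` from the closed form.** With `π̂_Q = P_Q(w₀; 1⃗)`:
`π̂ = c π̄` (`c = κ · ipSpDim(2n+1)`, uniqueness of the stationary vector of `t(½)`),
`Σ π̂ π̂' J = κ² ipSpDim(2n) ipSpDim(2n+2)` (the closed form evaluated), hence
`Σ π̄ π̄' J = ipSpDim(2n) ipSpDim(2n+2) / ipSpDim(2n+1)²`. [cite: IkhlefPonsaing2012, §4.4, Prop. 4.7 (proof)] -/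
theorem IsGroundState.stationary_pairing (hq : q ^ 2 + q + 1 = 0) {P : ColPattern n → MvPolynomial ℕ ℂ} {a : ℤ}
    (h : IsGroundState n q P a) {κ : ℂ} (hκ : κ ≠ 0) (hZ : zSumHat P = C κ * uChar ℂ 1 (2 * n + 1))
    (hN : nHat n P = C (κ ^ 2) * cHat ℂ n) :
    ∑ Q : ColPattern n, ∑ Q' : ColPattern n,
        ipStationaryL n Q * ipStationaryL n Q' * (if ipJunction n (Fin.last n) Q Q' = true then 1 else 0) =
      ((ipSpDim (2 * n) * ipSpDim (2 * n + 2) / ipSpDim (2 * n + 1) ^ 2 : ℚ) : ℝ) := by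
  classical
  obtain ⟨w₀, hw⟩ := IsAlgClosed.exists_pow_nat_eq (-q) (n := 2) two_pos
  have heven : ∀ Q, ∀ s ∈ (P Q).support, ∀ k, Even (s k) := fun Q s hs k => h.even_exponent hq Q hs k
  set pt : ℕ → ℂ := ipEvalPt w₀ with hpt
  set pt2 : ℕ → ℂ := fun k => ipEvalPt w₀ k ^ 2 with hpt2
  set πh : ColPattern n → ℂ := fun Q => eval pt (P Q) with hπh
  have hpt2 : ∀ k, 1 ≤ k → k ≤ 2 * n + 1 → pt2 k = 1 := fun k hk _ => by
    simp [hpt2, ipEvalPt, show k ≠ 0 by omega]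
  have hhalf : ∀ Q, eval pt2 (uHalf ℂ (P Q)) = πh Q := fun Q => by
    show eval pt2 (uHalf ℂ (P Q)) = eval pt (P Q)
    conv_rhs => rw [← h.uSq_uHalf_eq hq Q, eval_uSq]
  -- `Σ π̂ = κ ipSpDim(2n+1)`
  have hsum : ∑ Q, πh Q = κ * ((ipSpDim (2 * n + 1) : ℚ) : ℂ) := by
    have h1 := congrArg (eval pt2) hZ
    rw [zSumHat, map_sum, map_mul, eval_C, eval_sq_uChar w₀ 1 _ le_rfl] at h1
    rw [← h1]
    exact Finset.sum_congr rfl fun Q _ => (hhalf Q).symm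
  -- `Σ π̂ π̂' J = κ² ipSpDim(2n) ipSpDim(2n+2)`
  have hpair : ∑ Q, ∑ Q', πh Q * πh Q' * (if ipJunction n (Fin.last n) Q Q' = true then 1 else 0) =
      κ ^ 2 * ((ipSpDim (2 * n) * ipSpDim (2 * n + 2) : ℚ) : ℂ) := by
    have h1 := congrArg (eval pt2) hN
    rw [nHat, map_sum, map_mul, eval_C, eval_sq_cHat] at h1
    rw [← h1]
    refine Finset.sum_congr rfl fun Q _ => ?_
    rw [map_sum]
    refine Finset.sum_congr rfl fun Q' _ => ?_
    rw [map_mul, map_mul, eval_revAll_of_one _ hpt2, hhalf, hhalf]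
    congr 1
    split_ifs <;> simp
  -- `π̂ = c π̄`
  obtain ⟨c, hc⟩ := ipTMat0_complex_vecMul_line πh (h.eval_vecMul hq hw)
  have hc1 : c = κ * ((ipSpDim (2 * n + 1) : ℚ) : ℂ) := by
    rw [← hsum, hc]
    simp only [Pi.smul_apply, smul_eq_mul, ← Finset.mul_sum]
    rw [show (∑ Q, (ipStationaryL n Q : ℂ)) = ((∑ Q, ipStationaryL n Q : ℝ) : ℂ) by push_cast; rfl,
      sum_ipStationaryL]
    simp
  have hD : ((ipSpDim (2 * n + 1) : ℚ) : ℂ) ≠ 0 := by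
    have := ipSpDim_pos (2 * n + 1)
    exact_mod_cast this.ne'
  have hc0 : c ≠ 0 := by rw [hc1]; exact mul_ne_zero hκ hD
  -- conclude over `ℂ`, then over `ℝ`
  have key : (c ^ 2 : ℂ) * ((∑ Q, ∑ Q', ipStationaryL n Q * ipStationaryL n Q' *
      (if ipJunction n (Fin.last n) Q Q' = true then 1 else 0) : ℝ) : ℂ) =
      κ ^ 2 * ((ipSpDim (2 * n) * ipSpDim (2 * n + 2) : ℚ) : ℂ) := by
    rw [← hpair]
    push_cast
    rw [Finset.mul_sum]
    refine Finset.sum_congr rfl fun Q _ => ?_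
    rw [Finset.mul_sum]
    refine Finset.sum_congr rfl fun Q' _ => ?_
    rw [hc]
    simp only [Pi.smul_apply, smul_eq_mul]
    split_ifs <;> push_cast <;> ring
  have key' : ((∑ Q, ∑ Q', ipStationaryL n Q * ipStationaryL n Q' *
      (if ipJunction n (Fin.last n) Q Q' = true then 1 else 0) : ℝ) : ℂ) =
      (((ipSpDim (2 * n) * ipSpDim (2 * n + 2) / ipSpDim (2 * n + 1) ^ 2 : ℚ) : ℝ) : ℂ) := by
    have e1 : (c ^ 2 : ℂ) ≠ 0 := pow_ne_zero _ hc0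
    apply mul_left_cancel₀ e1
    rw [key, hc1]
    push_cast
    field_simp
  exact_mod_cast key'

/-- **Ikhlef–Ponsaing's Prop. 4.7 from the external bounds on the ground state**: if, for a fixed
primitive cube root of unity `q`, the primitive exact ground state of `t(w; z⃗)` satisfies the
`GroundStateBounds` (pair-degree bound and `w`-freeness of `Z`, IP12 §3.5 via the minimal-degree
solution of the qKZ system; vanishing at `z_1 = 0` on junction pairs) at every width `≥ 1`, then
`IkhlefPonsaingFirstPassage` holds. [cite: IkhlefPonsaing2012, Prop. 4.7] -/
theorem ikhlefPonsaingFirstPassage_of_bounds (hq : q ^ 2 + q + 1 = 0)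
    (hB : ∀ (k : ℕ) (P : ColPattern (k + 1) → MvPolynomial ℕ ℂ) (a : ℤ),
      IsGroundState (k + 1) q P a → GroundStateBounds (k + 1) P) :
    IkhlefPonsaingFirstPassage := by
  rw [ikhlefPonsaingFirstPassage_iff_lumped_pairing]
  intro m
  obtain ⟨P, a, h⟩ := exists_isGroundState hq m
  obtain ⟨-, κ, hκ, hZ, hN⟩ := IsGroundState.closedForm hq m P a h fun k P' a' _ h' => hB k P' a' h'
  exact h.stationary_pairing hq hκ hZ hN

end Homogeneous



end Literature.Probability.Percolation
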